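import Summits.ValiantsHypothesis.ValiantsHypothesis.Theorems.SuccinctLiftSmlAnyFieldDetBDS
import Summits.ValiantsHypothesis.ValiantsHypothesis.Theorems.DepthWindowHomContraction
import HarnessLib
import HarnessLib.Audit

/-!
# SuccinctLift — the HOMOGENISATION DOOR to the `𝔽̄₂` leaf of WALL-D:
`ImmHomAtOver K p q c₀ a ∧ 25·p·p′ ≤ 36·q·q′ ⟹ IMM hardness at slope p′/q′ over K`

Support file for wall D of `route-ValiantsHypothesis-SuccinctLift` (stmt-ValiantsHypothesis-23721,
`AlgDescentLog3`; census cell W34 «2-non-unit cut», ceiling_lift (a), whose VP-internal leaf is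
`¬ DetEasyOver 𝔽̄₂ (L₃ + 1)`).  Decomposition workshop decomp-valiant, lens 2 (gen 34), CALLED offer
O-L2-8 (critic bus 943), STAGE 2.  STAGE 1 (`DepthWindowHomContraction`) typed the homogenisation dial
over an arbitrary field, `ImmHomAtOver K p q c₀ a` (every circuit over `K` for `IMM_{n,d}` of product
depth `Δ` and size `s` has an every-gate-homogeneous one of depth `≤ ⌊pΔ/q⌋ + c₀` and size
`≤ (s + d n² + 2)^a·2^{a d²}`), and FLOORED it: `p < q` is impossible over every field.

THIS FILE is the DOOR (product form).  The tree's field-generic Bhargav–Dutta–Saxena kernel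
`SuccinctLiftSmlAnyFieldBDS.homBds_coreK` decides HOMOGENEOUS circuits over any field at every slope
`≤ 36/25` (`DepthWindow.BDS.fit_slope`); general circuits reach it today only through Forbes'
set-multilinearisation (slope `× 2`, hence the general window `≤ 18/25`,
`SuccinctLiftSmlAnyFieldDetBDS`).  Replacing that step by the dial: if `ImmHomAtOver K p q c₀ a` and
`25·p·p′ ≤ 36·q·q′` (`q, q′ > 0`), then for every `c`, eventually every circuit over `K` computing
`IMM_{m,⌊√log₂ m⌋}` in product depth `≤ ⌊p′·L₃ m/q′⌋ + c` has `> m^c + c` wires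
(`immHard_of_immHomAtOver`: prune dead gates, homogenise — depth `≤ ⌊pp′·L₃/(q′q)⌋ + ⌊pc/q⌋ + c₀ + 1`,
size `≤ (m^c + c + d m² + 2)^a·2^{a d²} ≤ m^{a(c+5)}` — and run `homBds_coreK` with the exponent
`c′ = a(c+5) + ⌊pc/q⌋ + c₀ + 1`; the corner `p p′ = 0` is constant depth and runs at slope `1/1`).
Through the engine-agnostic tower bookkeeping `not_detEasyOver_of_immHard` this gives
`¬ DetEasyOver K (⌊p′L₃/q′⌋ + K₀)`; at `K = 𝔽̄₂`, `p′ = q′ = 1`: every `ImmHomAtOver 𝔽̄₂ p q c₀ a` with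
`25 p ≤ 36 q` yields the W34 LEAF, hence `D_int(2, L₃+1)` (`nonUnitHardAt_two_of_immHomAtOver`), hence
`AlgDescentLog3` given the denominator half `DenominatorLiftAt 2 (L₃+1)` (`algDescentLog3_of_immHomAtOver`).
With the floor, the live window of the door is `σ = p/q ∈ [1, 36/25]` (`one_le_slope_of_immHomAtOver`).

What print knows (presearch, g34): homogenising constant-depth formulas/circuits in the low-degree
regime over POSITIVE characteristic at ANY constant slope is an open question — Fournier–Limaye–
Srinivasan–Tavenas, *On the power of homogeneous algebraic formulas* (STOC 2024), open question 3 —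
and the Girard–Newton route of LST's Lemma 11 (slope `2`, characteristic `0`) has no analogue in
characteristic `p` (ibid., Thm. 10); over `ℂ` every slope `< 2` is refuted for all targets
(`DepthWindowNotHomAtBelowTwo`).  So the door's hypothesis at `K = 𝔽̄₂`, `σ ∈ [1, 36/25]`, is OPEN and
not in print either way: IDEA-NEEDED, typed, doored and floored.  Nothing here is `S`-currency; items
30635 / 23721 / 23550 unchanged; rung 0; `VP ≠ VNP` untouched.

References: BhargavDuttaSaxena2024 (Thm. 1.4, Rem. 1.5); Forbes2024LowDepth (Thm. 1, Cor. 2);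
LimayeSrinivasanTavenas2025 (Lemma 11, Cor. 4); Burgisser2000 (§4.1); Valiant1979.
-/

noncomputable section

open MvPolynomial

-- the summit and the problem share the name `ValiantsHypothesis` (D-0017 single-conjunct layout)
set_option linter.dupNamespace false

namespace Summit.ValiantsHypothesis.ValiantsHypothesis.Theorems.SuccinctLiftHomDoor

open Literature.Computability.AlgebraicComplexity ArithCircuit
open Summit.ValiantsHypothesis.ValiantsHypothesis.Theses.SuccinctLift
open SuccinctLiftSmlAnyFieldBDS SuccinctLiftSmlAnyFieldDetBDS SuccinctLiftTwoNonUnit DepthWindow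
open DepthWindowHomContraction

/-! ### The homogeneous engine at slope `≤ 36/25`, packaged over any field -/

/-- **Homogeneous circuits over any field are large at every slope `P/Q ≤ 36/25`** (`1 ≤ P`):
`DepthWindow.BDS.fit_slope` + `homBds_coreK`, eventually in `m`.
[cite: BhargavDuttaSaxena2024, Thm. 1.4, Rem. 1.5] [cite: Forbes2024LowDepth, §1.2] -/
theorem homHard_bds (K : Type) [Field K] {P Q : ℕ} (hP : 1 ≤ P) (hQ : 0 < Q)
    (hPQ : 25 * P ≤ 36 * Q) (c : ℕ) :
    ∃ L₀ : ℕ, ∀ m : ℕ, 2 ^ max L₀ 100 ≤ m →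
      ∀ H : ArithCircuit K (Fin (Nat.sqrt (Nat.log 2 m)) × Fin m × Fin m),
        (∀ v ∈ ArithCircuit.gateValues H.gates, ∃ e : ℕ, v.IsHomogeneous e) →
        H.Computes (immPoly m (Nat.sqrt (Nat.log 2 m)) K) →
        H.productDepth ≤ P * Nat.log 2 (Nat.log 2 (Nat.log 2 m)) / Q + c → m ^ c + c < H.size := by
  obtain ⟨L₀, hL₀⟩ := BDS.fit_slope P Q c hP hQ hPQ
  refine ⟨L₀, fun m hm H hhom hHc hHpd => ?_⟩
  have hLge : L₀ ≤ Nat.log 2 m :=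
    le_trans (le_max_left _ _) (Nat.le_log_of_pow_le (by norm_num) hm)
  obtain ⟨hΔ2, hfit, h4⟩ := hL₀ (Nat.log 2 m) hLge
  exact homBds_coreK K c _ m rfl rfl hΔ2 hfit h4 H hhom hHc hHpd

/-! ### Slope bookkeeping -/

/-- Composing the dial's depth map `y ↦ ⌊py/q⌋ + c₀` after `y ≤ ⌊p′x/q′⌋ + c`:
`⌊py/q⌋ + c₀ ≤ ⌊pp′x/(q′q)⌋ + ⌊pc/q⌋ + c₀ + 1`. [cite: LimayeSrinivasanTavenas2025, Lemma 11] -/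
theorem slope_compose {p q c₀ p' q' c x y : ℕ} (hq : 0 < q) (hy : y ≤ p' * x / q' + c) :
    p * y / q + c₀ ≤ p * p' * x / (q' * q) + (p * c / q + c₀ + 1) := by
  have h1 : p * y ≤ p * p' * x / q' + p * c :=
    calc p * y ≤ p * (p' * x / q' + c) := Nat.mul_le_mul_left p hy
      _ = p * (p' * x / q') + p * c := mul_add _ _ _
      _ ≤ p * (p' * x) / q' + p * c :=
          Nat.add_le_add_right (Nat.mul_div_le_mul_div_assoc _ _ _) _
      _ = p * p' * x / q' + p * c := by rw [mul_assoc]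
  have h3 : p * c < q * (p * c / q + 1) := Nat.lt_mul_div_succ (p * c) hq
  have h2 : p * y / q ≤ (p * p' * x / q' + q * (p * c / q + 1)) / q :=
    Nat.div_le_div_right (by omega)
  rw [Nat.add_mul_div_left _ _ hq, Nat.div_div_eq_div_mul] at h2
  omega

/-! ### The door -/

/-- **THE DOOR (product form).**  If `ImmHomAtOver K p q c₀ a` and `25·p·p′ ≤ 36·q·q′` (`q, q′ > 0`),
then for every `c`, for all large `m`, every circuit over `K` (no homogeneity assumption) computing
`IMM_{m,⌊√log₂ m⌋}` in product depth `≤ ⌊p′·L₃(m)/q′⌋ + c` has `> m^c + c` wires.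
[cite: BhargavDuttaSaxena2024, Thm. 1.4, Rem. 1.5] [cite: LimayeSrinivasanTavenas2025, Lemma 11, Cor. 4]
[cite: Forbes2024LowDepth, Thm. 1] -/
theorem immHard_of_immHomAtOver (K : Type) [Field K] {p q c₀ a p' q' : ℕ}
    (hH : ImmHomAtOver K p q c₀ a) (hq : 0 < q) (hq' : 0 < q')
    (hσ : 25 * (p * p') ≤ 36 * (q * q')) (c : ℕ) :
    ∃ m₁ : ℕ, ∀ m : ℕ, m₁ ≤ m →
      ∀ D : ArithCircuit K (Fin (Nat.sqrt (Nat.log 2 m)) × Fin m × Fin m),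
        D.Computes (immPoly m (Nat.sqrt (Nat.log 2 m)) K) →
        D.productDepth ≤ p' * Nat.log 2 (Nat.log 2 (Nat.log 2 m)) / q' + c →
        m ^ c + c < D.edgeSize := by
  -- the exponent / additive constant handed to the engine
  obtain ⟨c', hc'⟩ : ∃ c', c' = a * (c + 5) + (p * c / q + c₀ + 1) := ⟨_, rfl⟩
  -- the engine slope `P₁/Q₁`: `pp′/(q′q)` if `pp′ ≥ 1`, else `1/1` (constant depth)
  obtain ⟨P₁, Q₁, hP₁, hQ₁, hPQ₁, hdepth⟩ : ∃ P₁ Q₁ : ℕ, 1 ≤ P₁ ∧ 0 < Q₁ ∧ 25 * P₁ ≤ 36 * Q₁ ∧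
      ∀ x y : ℕ, y ≤ p' * x / q' + c → p * y / q + c₀ ≤ P₁ * x / Q₁ + (p * c / q + c₀ + 1) := by
    rcases Nat.eq_zero_or_pos (p * p') with h0 | hpos
    · refine ⟨1, 1, le_rfl, Nat.one_pos, by norm_num, fun x y hy => ?_⟩
      have h := slope_compose (p := p) (c₀ := c₀) hq hy
      rw [h0] at h
      simp only [zero_mul, Nat.zero_div, zero_add] at h
      omega
    · exact ⟨p * p', q' * q, hpos, Nat.mul_pos hq' hq, by rw [mul_comm q' q]; exact hσ,
        fun x y hy => slope_compose hq hy⟩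
  obtain ⟨L₀, hL₀⟩ := homHard_bds K hP₁ hQ₁ hPQ₁ c'
  refine ⟨2 ^ max L₀ 100 + (c + 2), fun m hm D hD hpd => ?_⟩
  have hm' : 2 ^ max L₀ 100 ≤ m := le_trans (Nat.le_add_right _ _) hm
  have hmc : c + 2 ≤ m := le_trans (Nat.le_add_left _ _) hm
  have h100 : 2 ^ 100 ≤ m := le_trans (Nat.pow_le_pow_right (by norm_num) (le_max_right _ _)) hm'
  have hm0 : m ≠ 0 := by omega
  have hm1 : 1 ≤ m := by omega
  have hm3 : 3 ≤ m := by omega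
  by_contra hle
  push Not at hle
  -- prune the dead gates (`size ≤ edgeSize`), then homogenise
  obtain ⟨D', hD'e, hD'd, hD'w, hD's⟩ := exists_size_le_edgeSize D
  have hD'c : D'.Computes (immPoly m (Nat.sqrt (Nat.log 2 m)) K) := by
    rw [Computes, hD'e]; exact hD
  obtain ⟨H, hHc, hhom, hHpd, hHsize⟩ := hH m (Nat.sqrt (Nat.log 2 m)) D' hD'c
  have hHpd' : H.productDepth ≤ P₁ * Nat.log 2 (Nat.log 2 (Nat.log 2 m)) / Q₁ + c' := by
    have h := hdepth (Nat.log 2 (Nat.log 2 (Nat.log 2 m))) D'.productDepth (hD'd.trans hpd)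
    rw [hc']; omega
  have hcore := hL₀ m hm' H hhom hHc hHpd'
  -- but the homogenised circuit is small: `≤ (m^c + c + d m² + 2)^a · 2^{a d²} ≤ m^{a(c+5)} ≤ m^{c′}`
  obtain ⟨L, hL⟩ : ∃ L, L = Nat.log 2 m := ⟨_, rfl⟩
  obtain ⟨d, hd⟩ : ∃ d, d = Nat.sqrt L := ⟨_, rfl⟩
  have hHs : H.size ≤ (D'.size + d * (m * m) + 2) ^ a * 2 ^ (a * d * d) := by
    rw [hd, hL]; exact hHsize
  have h2L : 2 ^ L ≤ m := by rw [hL]; exact Nat.pow_log_le_self 2 hm0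
  have hdd : d * d ≤ L := by rw [hd]; exact Nat.sqrt_le L
  have hdm : d ≤ m := by
    rw [hd]; exact (Nat.sqrt_le_self L).trans (Nat.lt_two_pow_self.le.trans h2L)
  have h2dd : 2 ^ (d * d) ≤ m := (Nat.pow_le_pow_right (by norm_num) hdd).trans h2L
  have hbase : D'.size + d * (m * m) + 2 ≤ m ^ (c + 4) := by
    have h1 : D'.size ≤ m ^ c + c := hD's.trans (hD'w.trans hle)
    have h2 : m ^ c ≤ m ^ (c + 3) := Nat.pow_le_pow_right hm1 (by omega)
    have h3 : c + 2 ≤ m ^ (c + 3) := hmc.trans (Nat.le_self_pow (by omega) m)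
    have h4 : d * (m * m) ≤ m ^ (c + 3) :=
      calc d * (m * m) ≤ m * (m * m) := Nat.mul_le_mul_right _ hdm
        _ = m ^ 3 := by ring
        _ ≤ m ^ (c + 3) := Nat.pow_le_pow_right hm1 (by omega)
    calc D'.size + d * (m * m) + 2 ≤ 3 * m ^ (c + 3) := by omega
      _ ≤ m * m ^ (c + 3) := Nat.mul_le_mul_right _ hm3
      _ = m ^ (c + 4) := by ring
  have hHm : H.size ≤ m ^ c' + c' := by
    have h1 : (D'.size + d * (m * m) + 2) ^ a ≤ (m ^ (c + 4)) ^ a := Nat.pow_le_pow_left hbase a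
    have h2 : 2 ^ (a * d * d) ≤ m ^ a := by
      rw [show a * d * d = d * d * a by ring, pow_mul]; exact Nat.pow_le_pow_left h2dd a
    have h3 : a * (c + 5) ≤ c' := by rw [hc']; exact Nat.le_add_right _ _
    calc H.size ≤ (D'.size + d * (m * m) + 2) ^ a * 2 ^ (a * d * d) := hHs
      _ ≤ (m ^ (c + 4)) ^ a * m ^ a := Nat.mul_le_mul h1 h2
      _ = m ^ (a * (c + 5)) := by rw [← pow_mul, ← pow_add]; congr 1; ring
      _ ≤ m ^ c' := Nat.pow_le_pow_right hm1 h3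
      _ ≤ m ^ c' + c' := Nat.le_add_right _ _
  exact absurd hcore (not_lt.2 hHm)

/-- **The live window of the door is `σ ∈ [1, 36/25]`**: the floor of `DepthWindowHomContraction`
forces `q ≤ p` for any valid dial, over any field. [cite: LimayeSrinivasanTavenas2025, Lemma 11, Cor. 4] -/
theorem one_le_slope_of_immHomAtOver (K : Type) [Field K] {p q c₀ a : ℕ}
    (hH : ImmHomAtOver K p q c₀ a) : q ≤ p :=
  not_lt.1 fun h => not_immHomAtOver_of_lt K h hH

/-! ### Through the tower bookkeeping: determinant and permanent dials over `K` -/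

/-- **Door ⟹ the DETERMINANT dial over `K` at slope `p′/q′`.** [cite: Burgisser2024Completeness, Thm. 2.20]
[cite: BhargavDuttaSaxena2024, Thm. 1.4, Rem. 1.5] -/
theorem not_detEasyOver_of_immHomAtOver (K : Type) [Field K] {p q c₀ a p' q' : ℕ}
    (hH : ImmHomAtOver K p q c₀ a) (hq : 0 < q) (hq' : 0 < q')
    (hσ : 25 * (p * p') ≤ 36 * (q * q')) (K₀ : ℕ) :
    ¬ DetEasyOver K (fun n => p' * Nat.log 2 (Nat.log 2 (Nat.log 2 n)) / q' + K₀) :=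
  not_detEasyOver_of_immHard K (immHard_of_immHomAtOver K hH hq hq' hσ) K₀

/-- **Door ⟹ the PERMANENT dial over `K` at slope `p′/q′`.** [cite: Valiant1979]
[cite: BhargavDuttaSaxena2024, Thm. 1.4, Rem. 1.5] -/
theorem not_perEasyOver_of_immHomAtOver (K : Type) [Field K] {p q c₀ a p' q' : ℕ}
    (hH : ImmHomAtOver K p q c₀ a) (hq : 0 < q) (hq' : 0 < q')
    (hσ : 25 * (p * p') ≤ 36 * (q * q')) (K₀ : ℕ) :
    ¬ PerEasyOver K (fun n => p' * Nat.log 2 (Nat.log 2 (Nat.log 2 n)) / q' + K₀) :=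
  not_perEasyOver_of_immHard K (immHard_of_immHomAtOver K hH hq hq' hσ) K₀

/-- The uniform dial `HomAtOver K` opens the same door. [cite: LimayeSrinivasanTavenas2025, Lemma 11] -/
theorem not_detEasyOver_of_homAtOver (K : Type) [Field K] {p q c₀ a p' q' : ℕ}
    (hH : HomAtOver K p q c₀ a) (hq : 0 < q) (hq' : 0 < q')
    (hσ : 25 * (p * p') ≤ 36 * (q * q')) (K₀ : ℕ) :
    ¬ DetEasyOver K (fun n => p' * Nat.log 2 (Nat.log 2 (Nat.log 2 n)) / q' + K₀) :=
  not_detEasyOver_of_immHomAtOver K (immHomAtOver_of_homAtOver K hH) hq hq' hσ K₀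

/-! ### At `K = 𝔽̄₂`, slope `p′/q′ = 1`: the W34 leaf, `D_int(2, L₃+1)`, and `AlgDescentLog3` -/

/-- **Door ⟹ the VP-internal LEAF of W34**: an `IMM`-homogenisation over `𝔽̄₂` of any slope
`σ ≤ 36/25` gives `¬ DetEasyOver 𝔽̄₂ (L₃ + K₀)`. [cite: BhargavDuttaSaxena2024, Thm. 1.4, Rem. 1.5]
[cite: Forbes2024LowDepth, Cor. 2] -/
theorem not_detEasyOver_algClosure_two_of_immHomAtOver {p q c₀ a : ℕ}
    (hH : ImmHomAtOver (AlgebraicClosure (ZMod 2)) p q c₀ a) (hq : 0 < q) (hσ : 25 * p ≤ 36 * q)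
    (K₀ : ℕ) :
    ¬ DetEasyOver (AlgebraicClosure (ZMod 2)) (fun n => Nat.log 2 (Nat.log 2 (Nat.log 2 n)) + K₀) := by
  have h := not_detEasyOver_of_immHomAtOver (AlgebraicClosure (ZMod 2)) (p' := 1) (q' := 1) hH hq
    Nat.one_pos (by simpa using hσ) K₀
  have hfun : (fun n : ℕ => 1 * Nat.log 2 (Nat.log 2 (Nat.log 2 n)) / 1 + K₀) =
      fun n => Nat.log 2 (Nat.log 2 (Nat.log 2 n)) + K₀ := by
    funext n; simp
  rwa [hfun] at h

/-- **Door ⟹ `D_int(2, L₃ + K₀)`.** [cite: Burgisser2000, §4.1] [cite: BhargavDuttaSaxena2024, Thm. 1.4] -/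
theorem nonUnitHardAt_two_of_immHomAtOver {p q c₀ a : ℕ}
    (hH : ImmHomAtOver (AlgebraicClosure (ZMod 2)) p q c₀ a) (hq : 0 < q) (hσ : 25 * p ≤ 36 * q)
    (K₀ : ℕ) : NonUnitHardAt 2 (fun n => Nat.log 2 (Nat.log 2 (Nat.log 2 n)) + K₀) :=
  nonUnitHardAt_two_of_not_detEasyOver_algClosure _
    (not_detEasyOver_algClosure_two_of_immHomAtOver hH hq hσ K₀)

/-- **Door ⟹ WALL-D given the denominator half.**  An `IMM`-homogenisation over `𝔽̄₂` of any slope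
`σ ∈ [1, 36/25]` (the floor excludes `σ < 1`) closes `AlgDescentLog3` (item 23721) as soon as
`DenominatorLiftAt 2 (L₃+1)` holds — the conversion route to the `𝔽̄₂` leaf, typed.
[cite: Burgisser2000, §4.1] [cite: BhargavDuttaSaxena2024, Thm. 1.4, Rem. 1.5] [cite: Valiant1979] -/
theorem algDescentLog3_of_immHomAtOver {p q c₀ a : ℕ}
    (hH : ImmHomAtOver (AlgebraicClosure (ZMod 2)) p q c₀ a) (hq : 0 < q) (hσ : 25 * p ≤ 36 * q)
    (hden : DenominatorLiftAt 2 (fun n => Nat.log 2 (Nat.log 2 (Nat.log 2 n)) + 1)) :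
    AlgDescentLog3 :=
  algDescentLog3_of_detHard_algClosure_two
    (not_detEasyOver_algClosure_two_of_immHomAtOver hH hq hσ 1) hden

/-- **Door ⟹ `D_int(r, L₃ + K₀)` for every prime `r`** (through the permanent dial over `𝔽̄_r`).
[cite: Burgisser2000, §4.1] [cite: Valiant1979] -/
theorem nonUnitHardAt_of_immHomAtOver (r : ℕ) [Fact r.Prime] {p q c₀ a : ℕ}
    (hH : ImmHomAtOver (AlgebraicClosure (ZMod r)) p q c₀ a) (hq : 0 < q) (hσ : 25 * p ≤ 36 * q)
    (K₀ : ℕ) : NonUnitHardAt r (fun n => Nat.log 2 (Nat.log 2 (Nat.log 2 n)) + K₀) := by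
  have h := not_perEasyOver_of_immHomAtOver (AlgebraicClosure (ZMod r)) (p' := 1) (q' := 1) hH hq
    Nat.one_pos (by simpa using hσ) K₀
  have hfun : (fun n : ℕ => 1 * Nat.log 2 (Nat.log 2 (Nat.log 2 n)) / 1 + K₀) =
      fun n => Nat.log 2 (Nat.log 2 (Nat.log 2 n)) + K₀ := by
    funext n; simp
  rw [hfun] at h
  exact nonUnitHardAt_of_not_perEasyOver_algClosure _ h

end Summit.ValiantsHypothesis.ValiantsHypothesis.Theorems.SuccinctLiftHomDoor
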